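import Literature.MathematicalPhysics.PowerSystems.LossyMultimachineLurieForm
import HarnessLib

/-!
# GridStability/Lyapunov/RelativeLffNonUniform — the CLOSED-FORM Vu–Turitsyn certificate on Pai's
# machine-reference space for lossless classical models with NON-UNIFORM damping (generic, part 1:
# the LMI (QKH) collapses on Pai's structure; the closed form and its exact faces)

Venture GRIDFUSION, LFF lane; lead RULING R-LFF-NU-ROW (2026-08-27T06:44:49Z: «the generic
(n+1)-machine non-uniform closed form … Summits-side `Lyapunov/RelativeLffNonUniform.lean` (our theorem,
not a printed result)»; memo §3: the LFF-tier restriction «uniform damping only» lifted at `n = 3` by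
`WSCC9LffNonUniform{Data,,Roa}` p504302/p505072/p505678 — «generic statement pending»). Seat
gridfusion-lyap-1 (g5); namespace `Summit.Ventures.GridStability.Lyapunov.RelativeLffNU`. The uniform
case `D = λM` is g3's `RelativeLffClosedForm` (lit-6's `Certificate.relativeClosedForm`); here the
damping ratios `λ_i = D_i/M_i` are ARBITRARY positive numbers, so the object lives on Pai's
`(|ν| + |μ|)`-state machine-reference space `(ω | σ)` (lit-6 `System.machineReference`
[cite: Pai1981, §3.6.3 eq. (3.45)]), not on the `2|μ|`-state relative space.

§1 `machineReference_lmiMatrix_eq` / `certOfMachineReference` — BLOCK ALGEBRA OF (QKH) ONCE for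
`A = [[−Λ, 0], [T, 0]]`, `B = [Bω; 0]`, `C = [0 E]` (abstract index types `ν, μ, κ`; any `T`, `Bω`,
`E`): for `Q = [[Q_ωω, Q_σωᵀ], [Q_σω, Q_σσ]]` on the three FACES `Q_ωωBω = TᵀEᵀK`, `Q_σωBω = EᵀH`,
`Q_σσT = Q_σωΛ` the residual is `R = 0`, `AᵀQ + QA = [[−X, 0], [0, 0]]`,
`X = Q_ωωΛ + ΛQ_ωω − Q_σωᵀT − TᵀQ_σω`, and the LMI (QKH) [cite: VuTuritsyn2016, §III eq. (QKH)]
holds iff `X ⪰ 0` — an `|ν| × |ν|` fact instead of an `(|ν|+|μ|+|κ|)`-square one (the analogue of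
lit-6's `Certificate.ofSecondOrder` for the second-order structure).
§2 THE CLOSED FORM for LOSSLESS reciprocal channels `Bω = M⁻¹TᵀEᵀW` (`inputOf`), every positive
`M, D, w`, every `c′, h > 0` and ANY `T`, `E`: `Q_ωω = c′M`, `Q_σω = hÑ⁻¹TΛ⁻¹`, `Q_σσ = hÑ⁻¹`
(`Ñ⁻¹` = a given symmetric inverse of `Ñ = TD⁻¹Tᵀ`), `K = c′w`, `H = hw` satisfy the three faces
EXACTLY (`face₁`: `c′M·M⁻¹ = c′`; `face₂`: `Λ⁻¹M⁻¹ = D⁻¹` and `Ñ⁻¹Ñ = 1`; `face₃`: `Λ⁻¹Λ = 1`), so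
`closedFormCert` IS a certificate of `sysOf M D T E w δ* = machineReference (D/M) T (M⁻¹TᵀEᵀW) E δ*`
given the two small facts `X ⪰ 0` (`XOf`) and `Q − ε1 ⪰ 0` (`QOf`) — per instance one `decide` each
(the 9-bus instance p504302 certified the whole `11 × 11` LMI instead).
Sequel `RelativeLffNonUniformRefT.lean` (`T = refT`, reference machine `0`): the SHERMAN–MORRISON
inverse `Ñ⁻¹ = diag(D′) − D′D′ᵀ/ΣD` of `Ñ = TD⁻¹Tᵀ` with `Ñ⁻¹Ñ = 1` for every `D > 0`,
`refTᵀÑ⁻¹refT = D − uuᵀ/ΣD`, hence `X = 2c′D − h(2M − (muᵀ + umᵀ)/ΣD)` (`m = (M_i)`, `u = (D_i)`),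
the SCALAR sufficient condition `h(M_i/D_i + τ) ≤ c′` (`τ²ΣD ≥ ΣM²/D`) for `X ⪰ 0` and `Q ≻ 0`
(a certificate for EVERY lossless model with positive damping, solver-free), and the region /
synchronisation sentence for model-1's typed lossless models (`RecastData`).

THREE COLUMNS. CERTIFIED (kernel): theorem schemata about the MODEL CLASS = lossless network-reduced
classical multimachine model with per-machine damping `D_i > 0` (MV-2L; NO MV-λ) in Pai's
machine-reference coordinates; a certificate instance needs exactly the two facts named above.
VALIDATED: nothing (no SDP anywhere). No sentence of this file says that any grid is stable.
Definitions = bookkeeping (`lamOf`, `inputOf`, `sysOf`, `Q₁₁`, `Q₂₁`, `Q₂₂`, `QOf`, `XOf`,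
`certOfMachineReference`, `closedFormCert`); no named fact; standard axioms.
-/

noncomputable section

open Real Set Filter Matrix Finset
open Literature.MathematicalPhysics.PowerSystems
open Literature.MathematicalPhysics.PowerSystems.LyapunovFunctionFamily

namespace Summit.Ventures.GridStability.Lyapunov.RelativeLffNU

/-! ### Private linear-algebra plumbing -/

/-- A real matrix with `Pᵀ = P` and a non-negative quadratic form is positive semidefinite
(plumbing). -/
private theorem posSemidef_of_transpose_of_nonneg {m : Type*} [Fintype m] {P : Matrix m m ℝ}
    (hsymm : Pᵀ = P) (h : ∀ x : m → ℝ, 0 ≤ x ⬝ᵥ (P *ᵥ x)) : P.PosSemidef := by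
  refine Matrix.PosSemidef.of_dotProduct_mulVec_nonneg ?_ fun x => ?_
  · rw [Matrix.IsHermitian, Matrix.conjTranspose_eq_transpose_of_trivial]
    exact hsymm
  · rw [star_trivial]
    exact h x

/-- `z ⬝ Sum.elim a b = z∘inl ⬝ a + z∘inr ⬝ b` (plumbing). -/
private theorem dotProduct_sumElim {m k : Type*} [Fintype m] [Fintype k] (z : m ⊕ k → ℝ)
    (a : m → ℝ) (b : k → ℝ) :
    z ⬝ᵥ Sum.elim a b = (z ∘ Sum.inl) ⬝ᵥ a + (z ∘ Sum.inr) ⬝ᵥ b := by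
  simp [dotProduct, Fintype.sum_sum_type]

/-- Symmetry of a positive semidefinite real matrix as `Pᵀ = P` (plumbing). -/
private theorem transpose_eq_of_posSemidef {m : Type*} [Fintype m] {X : Matrix m m ℝ}
    (hX : X.PosSemidef) : Xᵀ = X := by
  have := hX.isHermitian
  rw [Matrix.IsHermitian, Matrix.conjTranspose_eq_transpose_of_trivial] at this
  exact this

/-- A block-diagonal matrix with positive semidefinite diagonal blocks is positive semidefinite
(plumbing). -/
private theorem posSemidef_fromBlocks_diag {m k : Type*} [Fintype m] [Fintype k]
    {X : Matrix m m ℝ} {Y : Matrix k k ℝ} (hX : X.PosSemidef) (hY : Y.PosSemidef) :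
    (Matrix.fromBlocks X 0 0 Y).PosSemidef := by
  refine posSemidef_of_transpose_of_nonneg ?_ fun z => ?_
  · rw [Matrix.fromBlocks_transpose, Matrix.transpose_zero, Matrix.transpose_zero,
      transpose_eq_of_posSemidef hX, transpose_eq_of_posSemidef hY]
  · rw [Matrix.fromBlocks_mulVec, dotProduct_sumElim]
    simp only [Matrix.zero_mulVec, add_zero, zero_add]
    have h1 := hX.dotProduct_mulVec_nonneg (z ∘ Sum.inl)
    have h2 := hY.dotProduct_mulVec_nonneg (z ∘ Sum.inr)
    rw [star_trivial] at h1 h2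
    exact add_nonneg h1 h2

/-! ### §1 The LMI (QKH) on Pai's machine-reference structure collapses to an `ν × ν` condition -/

section Abstract

variable {ν μ κ : Type*} [Fintype ν] [Fintype μ] [Fintype κ] [DecidableEq ν] [DecidableEq μ]
  [DecidableEq κ]

omit [DecidableEq μ] in
/-- **Block algebra of (QKH) on Pai's machine-reference structure, once.** For
`A = [[−Λ, 0], [T, 0]]`, `B = [Bω; 0]`, `C = [0 E]` (states `(ω | σ)` on `ν ⊕ μ`) and a block
`Q = [[Q₁₁, Q₂₁ᵀ], [Q₂₁, Q₂₂]]` with `Q₁₁`, `Q₂₂` symmetric and the three FACE identities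
`Q₁₁Bω = TᵀEᵀK` (ω-rows of `R`), `Q₂₁Bω = EᵀH` (σ-rows of `R`), `Q₂₂T = Q₂₁Λ` (the `(σ, ω)` block of
`AᵀQ + QA`): `R = QB − CᵀH − (KCA)ᵀ = 0` and `AᵀQ + QA = [[−X, 0], [0, 0]]` with
`X = Q₁₁Λ + ΛQ₁₁ − Q₂₁ᵀT − TᵀQ₂₁`, so the LMI matrix of (QKH) IS `[[ [[−X, 0], [0, 0]], 0], [0, −2H]]`.
[cite: VuTuritsyn2016, §III eq. (QKH); Pai1981, §3.6.3 eqs. (3.43)–(3.45)] -/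
theorem machineReference_lmiMatrix_eq (lam : ν → ℝ) (T : Matrix μ ν ℝ) (Bω : Matrix ν κ ℝ)
    (E : Matrix κ μ ℝ) (δs : κ → ℝ) (Q₁₁ : Matrix ν ν ℝ) (Q₂₁ : Matrix μ ν ℝ) (Q₂₂ : Matrix μ μ ℝ)
    (kK h : κ → ℝ) (h22 : Q₂₂ᵀ = Q₂₂)
    (hF1 : Q₁₁ * Bω = Tᵀ * (Eᵀ * Matrix.diagonal kK)) (hF2 : Q₂₁ * Bω = Eᵀ * Matrix.diagonal h)
    (hF3 : Q₂₂ * T = Q₂₁ * Matrix.diagonal lam) :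
    Matrix.fromBlocks
        ((System.machineReference lam T Bω E δs).Aᵀ * Matrix.fromBlocks Q₁₁ Q₂₁ᵀ Q₂₁ Q₂₂
          + Matrix.fromBlocks Q₁₁ Q₂₁ᵀ Q₂₁ Q₂₂ * (System.machineReference lam T Bω E δs).A)
        (Matrix.fromBlocks Q₁₁ Q₂₁ᵀ Q₂₁ Q₂₂ * (System.machineReference lam T Bω E δs).B
          - (System.machineReference lam T Bω E δs).Cᵀ * Matrix.diagonal h
          - (Matrix.diagonal kK * (System.machineReference lam T Bω E δs).C
              * (System.machineReference lam T Bω E δs).A)ᵀ)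
        (Matrix.fromBlocks Q₁₁ Q₂₁ᵀ Q₂₁ Q₂₂ * (System.machineReference lam T Bω E δs).B
          - (System.machineReference lam T Bω E δs).Cᵀ * Matrix.diagonal h
          - (Matrix.diagonal kK * (System.machineReference lam T Bω E δs).C
              * (System.machineReference lam T Bω E δs).A)ᵀ)ᵀ
        (-(2 : ℝ) • Matrix.diagonal h)
      = Matrix.fromBlocks
          (Matrix.fromBlocks (-(Q₁₁ * Matrix.diagonal lam + Matrix.diagonal lam * Q₁₁
            - Q₂₁ᵀ * T - Tᵀ * Q₂₁)) 0 0 0) 0 0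
          (-(2 : ℝ) • Matrix.diagonal h) := by
  have hA : (System.machineReference lam T Bω E δs).A
      = Matrix.fromBlocks (-Matrix.diagonal lam) 0 T 0 := rfl
  have hB : (System.machineReference lam T Bω E δs).B = Matrix.fromRows Bω 0 := rfl
  have hC : (System.machineReference lam T Bω E δs).C = Matrix.fromCols 0 E := rfl
  -- the transposed third face: `TᵀQ₂₂ = ΛQ₂₁ᵀ`
  have hF3t : Tᵀ * Q₂₂ = Matrix.diagonal lam * Q₂₁ᵀ := by
    have := congrArg Matrix.transpose hF3
    rwa [Matrix.transpose_mul, Matrix.transpose_mul, h22, Matrix.diagonal_transpose] at this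
  have hP : (System.machineReference lam T Bω E δs).Aᵀ * Matrix.fromBlocks Q₁₁ Q₂₁ᵀ Q₂₁ Q₂₂
      + Matrix.fromBlocks Q₁₁ Q₂₁ᵀ Q₂₁ Q₂₂ * (System.machineReference lam T Bω E δs).A
      = Matrix.fromBlocks (-(Q₁₁ * Matrix.diagonal lam + Matrix.diagonal lam * Q₁₁
            - Q₂₁ᵀ * T - Tᵀ * Q₂₁)) 0 0 0 := by
    rw [hA, Matrix.fromBlocks_transpose, Matrix.transpose_zero, Matrix.transpose_zero,
      Matrix.transpose_neg, Matrix.diagonal_transpose, Matrix.fromBlocks_multiply,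
      Matrix.fromBlocks_multiply, Matrix.fromBlocks_add]
    simp only [Matrix.zero_mul, Matrix.mul_zero, add_zero, zero_add, Matrix.neg_mul,
      Matrix.mul_neg, hF3, hF3t]
    congr 1
    · abel
    · rw [neg_add_cancel]
    · rw [neg_add_cancel]
  have hR : Matrix.fromBlocks Q₁₁ Q₂₁ᵀ Q₂₁ Q₂₂ * (System.machineReference lam T Bω E δs).B
      - (System.machineReference lam T Bω E δs).Cᵀ * Matrix.diagonal h
      - (Matrix.diagonal kK * (System.machineReference lam T Bω E δs).C
          * (System.machineReference lam T Bω E δs).A)ᵀ = 0 := by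
    rw [hA, hB, hC, Matrix.fromBlocks_mul_fromRows, Matrix.transpose_fromCols,
      Matrix.fromRows_mul, Matrix.mul_fromCols, Matrix.fromCols_mul_fromBlocks,
      Matrix.transpose_fromCols]
    simp only [Matrix.zero_mul, Matrix.mul_zero, add_zero, zero_add, Matrix.mul_neg, neg_zero,
      Matrix.transpose_zero, Matrix.transpose_mul, Matrix.diagonal_transpose, hF1, hF2]
    ext (i | a) j <;> simp [Matrix.fromRows]
  rw [hP, hR, Matrix.transpose_zero]

/-- **A structured certificate on Pai's machine-reference structure.** Data `Q₁₁` (`ν × ν`), `Q₂₁`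
(`μ × ν`), `Q₂₂` (`μ × μ`), `K, H` (per channel), `ε`, with `Q₁₁`, `Q₂₂` symmetric, the three faces
`Q₁₁Bω = TᵀEᵀK`, `Q₂₁Bω = EᵀH`, `Q₂₂T = Q₂₁Λ`, the RESIDUAL `X = Q₁₁Λ + ΛQ₁₁ − Q₂₁ᵀT − TᵀQ₂₁ ⪰ 0`,
`Q − ε·1 ⪰ 0`, `ε > 0`, `K ≥ 0`, `H > 0` IS a member of the family: the LMI (QKH) holds by
`machineReference_lmiMatrix_eq` (no `(|ν|+|μ|+|κ|)`-size semidefinite programme — one `ν × ν` fact).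
[cite: VuTuritsyn2016, §III eq. (QKH); Pai1981, §3.6.3 eq. (3.45)] -/
def certOfMachineReference (lam : ν → ℝ) (T : Matrix μ ν ℝ) (Bω : Matrix ν κ ℝ)
    (E : Matrix κ μ ℝ) (δs : κ → ℝ) (Q₁₁ : Matrix ν ν ℝ) (Q₂₁ : Matrix μ ν ℝ) (Q₂₂ : Matrix μ μ ℝ)
    (kK h : κ → ℝ) (ε : ℝ) (h11 : Q₁₁ᵀ = Q₁₁) (h22 : Q₂₂ᵀ = Q₂₂)
    (hF1 : Q₁₁ * Bω = Tᵀ * (Eᵀ * Matrix.diagonal kK)) (hF2 : Q₂₁ * Bω = Eᵀ * Matrix.diagonal h)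
    (hF3 : Q₂₂ * T = Q₂₁ * Matrix.diagonal lam)
    (hX : (Q₁₁ * Matrix.diagonal lam + Matrix.diagonal lam * Q₁₁ - Q₂₁ᵀ * T - Tᵀ * Q₂₁).PosSemidef)
    (hε : 0 < ε)
    (hQε : (Matrix.fromBlocks Q₁₁ Q₂₁ᵀ Q₂₁ Q₂₂ - ε • (1 : Matrix (ν ⊕ μ) (ν ⊕ μ) ℝ)).PosSemidef)
    (hK : ∀ k, 0 ≤ kK k) (hh : ∀ k, 0 < h k) :
    Certificate (System.machineReference lam T Bω E δs) where
  Q := Matrix.fromBlocks Q₁₁ Q₂₁ᵀ Q₂₁ Q₂₂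
  kK := kK
  h := h
  ε := ε
  Q_symm := by
    rw [Matrix.fromBlocks_transpose, Matrix.transpose_transpose, h11, h22]
  ε_pos := hε
  Q_ge := hQε
  kK_nonneg := hK
  h_pos := hh
  lmi := by
    rw [machineReference_lmiMatrix_eq lam T Bω E δs Q₁₁ Q₂₁ Q₂₂ kK h h22 hF1 hF2 hF3,
      Matrix.fromBlocks_neg, Matrix.fromBlocks_neg]
    simp only [neg_zero, neg_smul, neg_neg]
    refine posSemidef_fromBlocks_diag (posSemidef_fromBlocks_diag hX Matrix.PosSemidef.zero) ?_
    rw [← Matrix.diagonal_smul]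
    refine Matrix.PosSemidef.diagonal fun k => ?_
    simp only [Pi.smul_apply, smul_eq_mul]
    exact mul_nonneg (by norm_num) (hh k).le

end Abstract

/-! ### §2 THE CLOSED FORM for lossless reciprocal channels (`Bω = M⁻¹TᵀEᵀW`), any `T`, `E` -/

section ClosedForm

variable {ν μ κ : Type*} [Fintype ν] [Fintype μ] [Fintype κ] [DecidableEq ν] [DecidableEq μ]
  [DecidableEq κ]

/-- The per-machine damping ratios `λ_i = D_i / M_i` (NOT assumed equal). -/
def lamOf (M D : ν → ℝ) : ν → ℝ := fun i => D i / M i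

/-- The LOSSLESS reciprocal channel input `Bω = M⁻¹TᵀEᵀW` (channel `k` of weight `w_k` acts on the
speeds of both end machines with opposite signs, scaled by `1/M_i`). -/
def inputOf (M : ν → ℝ) (T : Matrix μ ν ℝ) (E : Matrix κ μ ℝ) (w : κ → ℝ) : Matrix ν κ ℝ :=
  Matrix.diagonal (fun i => 1 / M i) * (Tᵀ * (Eᵀ * Matrix.diagonal w))

/-- The machine-reference system of a lossless model with non-uniform damping:
`machineReference (D/M) T (M⁻¹TᵀEᵀW) E δ*`. [cite: Pai1981, §3.6.3 eq. (3.45)] -/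
def sysOf (M D : ν → ℝ) (T : Matrix μ ν ℝ) (E : Matrix κ μ ℝ) (w : κ → ℝ) (δs : κ → ℝ) :
    System (ν ⊕ μ) κ :=
  System.machineReference (lamOf M D) T (inputOf M T E w) E δs

/-- `Q_ωω = c′·M` (diagonal). -/
def Q₁₁ (M : ν → ℝ) (c' : ℝ) : Matrix ν ν ℝ := c' • Matrix.diagonal M

/-- `Q_σω = h·Ñ⁻¹TΛ⁻¹` (`Λ⁻¹ = diag(M_i/D_i)`, `Ñ⁻¹` = the given inverse of `Ñ = TD⁻¹Tᵀ`). -/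
def Q₂₁ (M D : ν → ℝ) (T : Matrix μ ν ℝ) (Ninv : Matrix μ μ ℝ) (h : ℝ) : Matrix μ ν ℝ :=
  h • (Ninv * (T * Matrix.diagonal (fun i => M i / D i)))

/-- `Q_σσ = h·Ñ⁻¹`. -/
def Q₂₂ (Ninv : Matrix μ μ ℝ) (h : ℝ) : Matrix μ μ ℝ := h • Ninv

/-- **The closed-form `Q`** `= [[c′M, hΛ⁻¹TᵀÑ⁻¹], [hÑ⁻¹TΛ⁻¹, hÑ⁻¹]]`. -/
def QOf (M D : ν → ℝ) (T : Matrix μ ν ℝ) (Ninv : Matrix μ μ ℝ) (c' h : ℝ) :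
    Matrix (ν ⊕ μ) (ν ⊕ μ) ℝ :=
  Matrix.fromBlocks (Q₁₁ M c') (Q₂₁ M D T Ninv h)ᵀ (Q₂₁ M D T Ninv h) (Q₂₂ Ninv h)

/-- **The residual** `X = Q_ωωΛ + ΛQ_ωω − Q_σωᵀT − TᵀQ_σω` (`= 2c′D − h(Λ⁻¹TᵀÑ⁻¹T + TᵀÑ⁻¹TΛ⁻¹)`;
for `T = refT`: `2c′D − h(2M − (muᵀ + umᵀ)/ΣD)`, `m = (M_i)`, `u = (D_i)`), the ONE `ν × ν`
condition the LMI (QKH) collapses to. -/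
def XOf (M D : ν → ℝ) (T : Matrix μ ν ℝ) (Ninv : Matrix μ μ ℝ) (c' h : ℝ) : Matrix ν ν ℝ :=
  Q₁₁ M c' * Matrix.diagonal (lamOf M D) + Matrix.diagonal (lamOf M D) * Q₁₁ M c'
    - (Q₂₁ M D T Ninv h)ᵀ * T - Tᵀ * Q₂₁ M D T Ninv h

omit [Fintype ν] in
/-- `Q_ωωᵀ = Q_ωω`. -/
theorem Q₁₁_transpose (M : ν → ℝ) (c' : ℝ) : (Q₁₁ M c')ᵀ = Q₁₁ M c' := by
  rw [Q₁₁, Matrix.transpose_smul, Matrix.diagonal_transpose]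

omit [Fintype μ] [DecidableEq μ] in
/-- `Q_σσᵀ = Q_σσ` for symmetric `Ñ⁻¹`. -/
theorem Q₂₂_transpose {Ninv : Matrix μ μ ℝ} (hNt : Ninvᵀ = Ninv) (h : ℝ) :
    (Q₂₂ Ninv h)ᵀ = Q₂₂ Ninv h := by
  rw [Q₂₂, Matrix.transpose_smul, hNt]

omit [DecidableEq μ] in
/-- **Face 1 (ω-rows of `R`)**: `Q_ωωBω = TᵀEᵀK` with `K = c′w` — EXACT for every `M ≠ 0`
(`c′M · M⁻¹TᵀEᵀW = c′TᵀEᵀW`). -/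
theorem face₁ (M : ν → ℝ) (T : Matrix μ ν ℝ) (E : Matrix κ μ ℝ) (w : κ → ℝ) (c' : ℝ)
    (hM : ∀ i, M i ≠ 0) :
    Q₁₁ M c' * inputOf M T E w = Tᵀ * (Eᵀ * Matrix.diagonal (fun k => c' * w k)) := by
  have hd : Matrix.diagonal M * Matrix.diagonal (fun i => 1 / M i) = (1 : Matrix ν ν ℝ) := by
    rw [Matrix.diagonal_mul_diagonal, ← Matrix.diagonal_one]
    congr 1; funext i; rw [mul_one_div, div_self (hM i)]
  have hw : Matrix.diagonal (fun k => c' * w k) = c' • Matrix.diagonal w := by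
    rw [← Matrix.diagonal_smul]; rfl
  rw [Q₁₁, inputOf, Matrix.smul_mul, ← Matrix.mul_assoc (Matrix.diagonal M), hd, Matrix.one_mul,
    hw, Matrix.mul_smul, Matrix.mul_smul]

/-- **Face 2 (σ-rows of `R`)**: `Q_σωBω = EᵀH` with `H = hw` — EXACT because `Λ⁻¹M⁻¹ = D⁻¹` and
`Ñ⁻¹(TD⁻¹Tᵀ) = 1`. -/
theorem face₂ (M D : ν → ℝ) (T : Matrix μ ν ℝ) (E : Matrix κ μ ℝ) (w : κ → ℝ)
    (Ninv : Matrix μ μ ℝ) (h : ℝ) (hM : ∀ i, M i ≠ 0)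
    (hN : Ninv * (T * (Matrix.diagonal (fun i => 1 / D i) * Tᵀ)) = 1) :
    Q₂₁ M D T Ninv h * inputOf M T E w = Eᵀ * Matrix.diagonal (fun k => h * w k) := by
  have hd : Matrix.diagonal (fun i => M i / D i) * Matrix.diagonal (fun i => 1 / M i)
      = Matrix.diagonal (fun i => 1 / D i) := by
    rw [Matrix.diagonal_mul_diagonal]
    congr 1; funext i; field_simp [hM i]
  have hw : Matrix.diagonal (fun k => h * w k) = h • Matrix.diagonal w := by
    rw [← Matrix.diagonal_smul]; rfl
  have key : Ninv * (T * (Matrix.diagonal (fun i => M i / D i) * (Matrix.diagonal (fun i => 1 / M i)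
      * (Tᵀ * (Eᵀ * Matrix.diagonal w)))))
      = (Ninv * (T * (Matrix.diagonal (fun i => 1 / D i) * Tᵀ))) * (Eᵀ * Matrix.diagonal w) := by
    rw [← Matrix.mul_assoc (Matrix.diagonal fun i => M i / D i), hd]
    simp only [Matrix.mul_assoc]
  rw [Q₂₁, inputOf, Matrix.smul_mul, Matrix.mul_assoc, Matrix.mul_assoc, key, hN, Matrix.one_mul,
    hw, Matrix.mul_smul]

omit [DecidableEq μ] in
/-- **Face 3 (the `(σ, ω)` block of `AᵀQ + QA`)**: `Q_σσT = Q_σωΛ` — EXACT (`Λ⁻¹Λ = 1`). -/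
theorem face₃ (M D : ν → ℝ) (T : Matrix μ ν ℝ) (Ninv : Matrix μ μ ℝ) (h : ℝ)
    (hM : ∀ i, M i ≠ 0) (hD : ∀ i, D i ≠ 0) :
    Q₂₂ Ninv h * T = Q₂₁ M D T Ninv h * Matrix.diagonal (lamOf M D) := by
  have hd : Matrix.diagonal (fun i => M i / D i) * Matrix.diagonal (lamOf M D)
      = (1 : Matrix ν ν ℝ) := by
    rw [Matrix.diagonal_mul_diagonal, ← Matrix.diagonal_one]
    congr 1; funext i; unfold lamOf; field_simp [hM i, hD i]
  rw [Q₂₂, Q₂₁, Matrix.smul_mul, Matrix.smul_mul, Matrix.mul_assoc, Matrix.mul_assoc, hd,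
    Matrix.mul_one]

/-- **THE CLOSED-FORM CERTIFICATE from two small facts.** For positive `M, D, w`, `c′, h, ε > 0`,
a symmetric `Ñ⁻¹` with `Ñ⁻¹(TD⁻¹Tᵀ) = 1`, the residual `X ⪰ 0` (`ν × ν`) and the coercivity
`Q − ε1 ⪰ 0` (`(ν ⊕ μ)`-square): `(Q, K = c′w, H = hw, ε)` is a member of Vu–Turitsyn's family on
Pai's machine-reference space with NON-uniform damping — all three faces of (QKH) hold exactly
(`face₁`–`face₃`), and `certOfMachineReference` does the rest. Per instance the two facts are one
`decide` each. [cite: VuTuritsyn2016, §III eq. (QKH); Pai1981, §3.6.3 eq. (3.45)] -/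
def closedFormCert (M D : ν → ℝ) (T : Matrix μ ν ℝ) (E : Matrix κ μ ℝ) (w : κ → ℝ) (δs : κ → ℝ)
    (Ninv : Matrix μ μ ℝ) (c' h ε : ℝ) (hM : ∀ i, 0 < M i) (hD : ∀ i, 0 < D i)
    (hw : ∀ k, 0 < w k) (hc' : 0 < c') (hh : 0 < h) (hε : 0 < ε) (hNt : Ninvᵀ = Ninv)
    (hN : Ninv * (T * (Matrix.diagonal (fun i => 1 / D i) * Tᵀ)) = 1)
    (hX : (XOf M D T Ninv c' h).PosSemidef)
    (hQ : (QOf M D T Ninv c' h - ε • (1 : Matrix (ν ⊕ μ) (ν ⊕ μ) ℝ)).PosSemidef) :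
    Certificate (sysOf M D T E w δs) :=
  certOfMachineReference (lamOf M D) T (inputOf M T E w) E δs (Q₁₁ M c') (Q₂₁ M D T Ninv h)
    (Q₂₂ Ninv h) (fun k => c' * w k) (fun k => h * w k) ε (Q₁₁_transpose M c')
    (Q₂₂_transpose hNt h) (face₁ M T E w c' fun i => (hM i).ne')
    (face₂ M D T E w Ninv h (fun i => (hM i).ne') hN)
    (face₃ M D T Ninv h (fun i => (hM i).ne') fun i => (hD i).ne') hX hε hQ
    (fun k => (mul_pos hc' (hw k)).le) fun k => mul_pos hh (hw k)

/-- The certificate's data, by name. -/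
theorem closedFormCert_Q (M D : ν → ℝ) (T : Matrix μ ν ℝ) (E : Matrix κ μ ℝ) (w : κ → ℝ)
    (δs : κ → ℝ) (Ninv : Matrix μ μ ℝ) (c' h ε : ℝ) (hM : ∀ i, 0 < M i) (hD : ∀ i, 0 < D i)
    (hw : ∀ k, 0 < w k) (hc' : 0 < c') (hh : 0 < h) (hε : 0 < ε) (hNt : Ninvᵀ = Ninv)
    (hN : Ninv * (T * (Matrix.diagonal (fun i => 1 / D i) * Tᵀ)) = 1)
    (hX : (XOf M D T Ninv c' h).PosSemidef)
    (hQ : (QOf M D T Ninv c' h - ε • (1 : Matrix (ν ⊕ μ) (ν ⊕ μ) ℝ)).PosSemidef) :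
    (closedFormCert M D T E w δs Ninv c' h ε hM hD hw hc' hh hε hNt hN hX hQ).Q = QOf M D T Ninv c' h
      ∧ (closedFormCert M D T E w δs Ninv c' h ε hM hD hw hc' hh hε hNt hN hX hQ).kK
          = (fun k => c' * w k)
      ∧ (closedFormCert M D T E w δs Ninv c' h ε hM hD hw hc' hh hε hNt hN hX hQ).h
          = (fun k => h * w k)
      ∧ (closedFormCert M D T E w δs Ninv c' h ε hM hD hw hc' hh hε hNt hN hX hQ).ε = ε :=
  ⟨rfl, rfl, rfl, rfl⟩

end ClosedForm



end Summit.Ventures.GridStability.Lyapunov.RelativeLffNU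

end
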